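import Summits.HodgeConjecture.HodgeConjecture.Theorems.Ring2TransportWeilClasses
import Summits.HodgeConjecture.HodgeConjecture.Theses.RankFourFaces
import Literature.AlgebraicGeometry.Milne1999.HodgeCMImpliesTateFiniteFields
import Literature.AlgebraicGeometry.HodgeTheory.SemiregularVariationalHodge
import Literature.AlgebraicGeometry.HodgeTheory.SemiregularVariationalHodgeFull
import Literature.AlgebraicGeometry.HodgeTheory.SemiregularVariationalHodgeTwisted
import Literature.AlgebraicGeometry.HodgeTheory.HodgeLocus
import Literature.AlgebraicGeometry.HodgeTheory.IsoTransport
import Literature.AlgebraicGeometry.Motives.VarietiesGeometricallyIntegralProofs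
import HarnessLib

/-!
# Ring 2 — transport hypotheses II: the SEMIREGULARITY route (S) at CM fibres

HONEST FRAMING (page 1, verbatim the cell's standing line): **research route conditional on HC_CM; not a
corollary; Q11.4-sentence-2 already refuted in dim ≥ 3.** `HC_CM` (= the tree item
`Summit.HodgeConjecture.HodgeConjecture.Theses.RankFourFaces.CMAbelianHodge`, stmt-HodgeConjecture-3052, by
name) is an explicit HYPOTHESIS (binder) of every conditional theorem below; it is never cited as known and no
internally-adjudicated package statement is used. Markman's preprints arXiv:2502.03415 [M], 2509.23079 [C],
2509.23403 [S] and Perry's arXiv:2604.00511 are UNREFEREED and cited as such. Nothing here is a case of the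
Hodge conjecture.

Re-based on the LANDED `Theorems/Ring2TransportWeilClasses.lean` (namespace `…Ring2Transport`:
`CMPointedWeilFamiliesQuadratic`, `CMPointedWeilFamiliesCMField`, `LocalWeilVHCAtCMQuadratic`,
`mem_algebraicClasses_of_cmChart`, `HC_WeilClasses{Quadratic,CMField}_of_HC_CM[_local]`), whose declarations are
used BY NAME and not re-typed (referee ruling ref1 F4). This file adds, in the same namespace:

* **(S2) Markman's schema with NO CM input.** `SemiregularAnchor C f n m W` (DATA: finitely many fully
  semiregular finite locally free sheaves `E_i` on ONE fibre with rational algebraic `B`-fields `B_i`, flat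
  Hodge-valued extensions `w_{i,k}` of `(exp(B_i) ∪ ch(E_i))_k`, and `W|_{𝒳_s} = Σ q_i w_{i,m}(s)` — the
  hypothesis shape of Perry's Thm. 1.1 (2) AS PRINTED, `ℚ`-linearly extended); H-SR = the tree's verbatim
  transcription `Perry2026_semiregularTwisted_remainsAlgebraic` of Perry's claim (OPEN in Lean; used by name,
  informally `SemiregularTransport`); `SemiregularlyAnchoredWeilFamiliesCMField C` (R3anc with "algebraic at
  `s₀`" replaced by "semiregularly anchored"); and the kernel composition
  `weilClassesCMField_of_semiregularlyAnchored_of_perry` — R3 with no `HC_CM` and no variational Hodge hypothesis.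
* **(S3) the hybrid — the cell brief's `Semiregular ⟨Weil, K CM field⟩` input.** `SemiregularLiftAtCMPoints C`:
  at a CM fibre, an ALGEBRAIC Weil-confined class (what `HC_CM` delivers) admits a semiregular anchor. With it,
  `HC_CM → CMPointedWeilFamiliesCMField → SemiregularLiftAtCMPoints C → Perry2026_semiregularTwisted_remainsAlgebraic
  → WeilClassesCMField` (`HC_WeilClassesCMField_of_HC_CM_of_semiregularLift`). By referee ruling ref1 F2 this is
  the ONE transport row on which `HC_CM` is load-bearing IN PRINT (non-split Weil type over a CM field of degree
  `> 2`: no algebraic anchor is known in print; André 1996 Lemme 6.3.3 is split-only, Markman [C] §1.1 postpones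
  semiregular secant sheaves for `[K:ℚ] > 2`). CAVEAT (ref1 F5): as a `∀`-statement `SemiregularLiftAtCMPoints C`
  is PLAUSIBLY FALSE — obstructed representatives are generic (tree file
  `HodgeTheory/SemiregularityWeakCriterionAbelianCounterexample.lean`); its closest print is Markman [S]
  Question 11.4 SENTENCE 1 (open) and [C] Thm. 1.1.2 with the sheaf GIVEN; a per-family WITNESS
  (`Nonempty (SemiregularAnchor …)` for the specific Mumford–Tate family) is the preferred form, which is why
  the anchor is DATA here.

The density / torus forms (H-D), (H-CM) and the typed conditional "under `HC_CM` each Weil rung IS its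
transport leaf" are in the companion `Theorems/Ring2TransportCMDensity.lean`.

Only STRICT semiregularity (Bloch 1972 Thm. 7.1; Buchweitz–Flenner 2003 Thm. 5.1; Perry 2026 Thm. 1.1) is
typed; the WEAK criterion of [S] Question 11.4 sentence 2 is refuted for abelian varieties of dimension ≥ 3
(`HodgeTheory/SemiregularityWeakCriterionAbelianCounterexampleFull.lean`) and no hypothesis of that shape
appears (referee C5). The smooth irreducible base is INTEGRAL (smooth over `ℂ` ⟹ reduced,
`Motives.isReduced_of_smooth_over_field`; with irreducible ⟹ integral), which is how Perry's integrality
hypothesis is met without adding a conjunct to the landed CM-pointed families.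

References (bib keys): Perry2026Semiregularity (Thm. 1.1, §1.3), BuchweitzFlenner2003 (Thm. 5.1),
Bloch1972Semiregularity (Thm. 7.1, 7.4), Markman2025SecantRealMultiplication ([C] §1.1, Thm. 1.1.2,
Cor. 10.2.3, Question 11.2.2), Markman2025SurveySecant ([S] Question 11.4, §12), Markman2025SecantWeil ([M]
§1.1, Thm. 1.5.1, Conj. 7.3.9), HuybrechtsStellari2005 (§1), Deligne1982HodgeCycles (§6 Prop. 6.1, Thm. 4.8),
CharlesSchnell2014Notes (Conj. 11.3.1, Thm. 11.5.11), Mumford1969NoteShimura (§3), Andre1996Motifs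
(Lemme 6.3.3), Milne1999 (§2, §7), StacksProject (Tag 056T).
-/

set_option linter.dupNamespace false

noncomputable section

open CategoryTheory

namespace Summit.HodgeConjecture.HodgeConjecture.Ring2Transport

open Literature.AlgebraicGeometry Literature.AlgebraicGeometry.Motives
open Literature.AlgebraicGeometry.HodgeTheory
open Literature.AlgebraicTopology.SingularHomology
open Literature.AlgebraicGeometry.Milne1999 (IsOfCMType)
open Summit.HodgeConjecture.HodgeConjecture.WeilTypeLadder
open Summit.HodgeConjecture.HodgeConjecture.Theses

/-! ## (S2) Markman's line: semiregular anchors and the semiregularity theorem — NO CM input -/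

/-- **A SEMIREGULAR ANCHOR of a global class, WITH `B`-FIELDS** (DATA, a `structure` in `Type`: the
hypothesis-shape of the tree fact `Perry2026_semiregularTwisted_remainsAlgebraic` — Perry's Thm. 1.1 (2) AS
PRINTED, `B`-field included — `ℚ`-linearly extended). A semiregular anchor of the global class
`W ∈ H^{2m}(𝒳(ℂ); ℂ)` of the family `f` (relative dimension `n`) for the Chern character theory `C` consists
of: ONE point `s₀`; finitely many finite locally free FULLY SEMIREGULAR sheaves `E_i` on `𝒳_{s₀}`
(`IsISemiregular _ Set.univ`: the whole Buchweitz–Flenner map `(σ_q)_q` is injective on `Ext²(E_i, E_i)`;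
`{0,1}`-semiregular sheaves qualify, `isISemiregular_univ_of_isZeroOneSemiregular`); RATIONAL ALGEBRAIC classes
`B_i ∈ H²(𝒳_{s₀})` (the `B`-fields); rationals `q_i`; CONTINUOUS sections `w_{i,k}` of the étalé spaces of
`R^{2k}f_*ℂ` valued in the locus of Hodge classes with `w_{i,k}(s₀) = (exp(B_i) ∪ ch(E_i))_k` (`expTwistCh`) for
all `k`; and the identity `W|_{𝒳_s} = Σ_i q_i · w_{i,m}(s)` on every fibre. (A single sheaf with `κ_m = W|_s`
exactly would exclude e.g. `-θ^m`; hence `ℚ`-combinations.) Printed model, verbatim (Perry, arXiv:2604.00511,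
unrefereed, Thm. 1.1): "let `E_0 ∈ D_perf(X_0)` be a semiregular perfect complex with `Ext^{<0}(E_0,E_0) = 0`.
Assume that `B_0 ∈ H²(X_0, ℚ(1))` is an algebraic class such that `w_0 = exp(B_0)·ch(E_0)` […] remains Hodge
along `S`". Markman's `B`-secant sheaves `E = Φ(F₁ ⊠ F₂^∨)` with `B = -c₁(E)/rk E` — so that `exp(B)·ch(E)` is
his `Spin(V)_{η,B}`-invariant class `κ(E)` ([M] §1.1), flat and Hodge along the Weil family — are the intended
`(E_i, B_i)` AFTER one lifting (they are REFLEXIVE; the tree's semiregularity map `sigmaHigher` and Perry's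
transcription are for finite LOCALLY FREE sheaves; [M] Conj. 7.3.9 / §7.4.2 treat the twisted reflexive case).
The `B = 0`, `{0,1}`-semiregular shape is the constructor `SemiregularAnchor.ofZeroOne`. The hypotheses below
only assert `Nonempty` of it. [cite: Perry2026Semiregularity, Thm. 1.1 (preprint, unrefereed)]
[cite: BuchweitzFlenner2003, §5 Thm. 5.1] [cite: HuybrechtsStellari2005, §1]
[cite: Markman2025SecantWeil, §1.1, Conj. 7.3.9 and §7.4.2 (preprint, unrefereed)] -/
structure SemiregularAnchor (C : ChernCharacterBetti) {𝒳 S : SchemeOver ℂ} (f : 𝒳 ⟶ S) (n m : ℕ)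
    (W : complexBetti 𝒳 (2 * m)) where
  /-- number of sheaves -/
  r : ℕ
  /-- rational coefficients -/
  q : Fin r → ℚ
  /-- the anchor point -/
  s₀ : ComplexPoints S
  /-- the sheaves on the anchor fibre -/
  E : Fin r → (fiberOver f s₀).left.Modules
  finiteLocallyFree : ∀ i, IsFiniteLocallyFree (E i)
  /-- the `B`-fields on the anchor fibre -/
  B : Fin r → complexBetti (fiberOver f s₀) 2
  rationalB : ∀ i, IsRationalClass (B i)
  algebraicB : ∀ i, B i ∈ algebraicClasses (fiberOver f s₀) 1
  /-- the flat (continuous, Hodge-valued) extensions of their twisted Chern characters -/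
  w : Fin r → ∀ (k : ℕ) (s : ComplexPoints S), complexBetti (fiberOver f s) (2 * k)
  semiregular : ∀ i, IsISemiregular (finiteLocallyFree i) Set.univ
  continuous : ∀ i k, Continuous fun s => (⟨s, w i k s⟩ : FiberClass f (2 * k))
  hodge : ∀ i k s, (⟨s, w i k s⟩ : FiberClass f (2 * k)) ∈ locusOfHodgeClasses f n k
  chern : ∀ i k, w i k s₀ = expTwistCh C (fiberOver f s₀) (B i) (E i) k
  sum_eq : ∀ s : ComplexPoints S, complexBetti.map (fiberι f s) (2 * m) W = ∑ i, ((q i : ℚ) : ℂ) • w i m s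

/-- **The `B = 0` anchor shape is a case**: `{0,1}`-semiregular finite locally free `E_i` whose PLAIN Chern
characters `ch_k(E_i)` extend as Hodge sections give a semiregular anchor with all `B_i = 0` (`0` is rational and
algebraic; `(exp(0) ∪ ch(E))_k = ch_k(E)`, tree `expTwistCh_zero`; `{0,1}`-semiregular ⇒ fully semiregular, tree
`isISemiregular_univ_of_isZeroOneSemiregular`). [cite: BuchweitzFlenner2003, §5 (I-semiregular)]
[cite: HuybrechtsStellari2005, §1] -/
def SemiregularAnchor.ofZeroOne (C : ChernCharacterBetti) {𝒳 S : SchemeOver ℂ} (f : 𝒳 ⟶ S) (n m : ℕ)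
    (W : complexBetti 𝒳 (2 * m)) (r : ℕ) (q : Fin r → ℚ) (s₀ : ComplexPoints S)
    (E : Fin r → (fiberOver f s₀).left.Modules) (hE : ∀ i, IsFiniteLocallyFree (E i))
    (w : Fin r → ∀ (k : ℕ) (s : ComplexPoints S), complexBetti (fiberOver f s) (2 * k))
    (hsr : ∀ i, IsZeroOneSemiregular (hE i))
    (hwc : ∀ i k, Continuous fun s => (⟨s, w i k s⟩ : FiberClass f (2 * k)))
    (hwH : ∀ i k s, (⟨s, w i k s⟩ : FiberClass f (2 * k)) ∈ locusOfHodgeClasses f n k)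
    (hch : ∀ i k, w i k s₀ = C.ch (fiberOver f s₀) (E i) k)
    (hsum : ∀ s : ComplexPoints S, complexBetti.map (fiberι f s) (2 * m) W = ∑ i, ((q i : ℚ) : ℂ) • w i m s) :
    SemiregularAnchor C f n m W where
  r := r
  q := q
  s₀ := s₀
  E := E
  finiteLocallyFree := hE
  B := fun _ => 0
  rationalB := fun _ => IsRationalClass.zero
  algebraicB := fun _ => Submodule.zero_mem _
  w := w
  semiregular := fun i => isISemiregular_univ_of_isZeroOneSemiregular (hE i) (hsr i)
  continuous := hwc
  hodge := hwH
  chern := fun i k => by rw [expTwistCh_zero]; exact hch i k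
  sum_eq := hsum

/-! **H-SR (`SemiregularTransport`) — THE SEMIREGULARITY THEOREM WITH `B`-FIELD FOR FAMILIES OVER A
QUASI-PROJECTIVE BASE** (OPEN HYPOTHESIS: by name the tree's VERBATIM transcription `HodgeTheory.Perry2026_semiregularTwisted_remainsAlgebraic`
of an UNREFEREED preprint claim, registered here as a "would need" of the transport and NOT asserted).
Statement (tree docstring): for a smooth projective family `f : X → S` over a smooth integral quasi-projective
base, a finite locally free FULLY SEMIREGULAR `E₀` on `X_{s₀}`, a rational algebraic `B₀ ∈ H²(X_{s₀})`, and
continuous Hodge-valued sections `w_k` of `R^{2k}f_*ℂ` with `w_k(s₀) = (exp(B₀) ∪ ch(E₀))_k` for all `k`: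
"`w_k(s)` is an algebraic class of `X_s` for every `s ∈ S(ℂ)` and every `k`". Closest print, verbatim: Perry,
arXiv:2604.00511 (2026, unrefereed), Thm. 1.1: "Let `f : X → S` be a smooth proper family of complex
varieties. Let `0 ∈ S(ℂ)` be a point and let `E_0 ∈ D_perf(X_0)` be a semiregular perfect complex with
`Ext^{<0}(E_0, E_0) = 0`. Assume that `B_0 ∈ H²(X_0, ℚ(1))` is an algebraic class such that
`w_0 = exp(B_0) · ch(E_0)` […] remains Hodge along `S` […] (2) […] remains algebraic"; the PUBLISHED germ
version is Buchweitz–Flenner, Compositio Math. 137 (2003) Thm. 5.1 (tree fact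
`BuchweitzFlenner2003_variationalHodge_semiregular`: "then `α_p(s)` is algebraic for all `s` near `0`"), and
the embedded case is Bloch, Invent. Math. 17 (1972) Thm. (7.1) (tree fact `Bloch1972_semiregularSubschemeLifts`).
Passing from the germ to the whole quasi-projective base is exactly what is under review. Used BY NAME
below — every binder `(hP : Perry2026_semiregularTwisted_remainsAlgebraic)` shows the tree fact, no summit-side
copy or abbreviation is introduced (sources: Perry2026Semiregularity Thm. 1.1 (2), preprint, unrefereed;
BuchweitzFlenner2003 §5 Thm. 5.1; Bloch1972Semiregularity Thm. (7.1)). NOT asserted; status open. -/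

/-- H-SR (`B`-field form) implies the `B = 0`, `{0,1}`-semiregular registration through the tree edges
`Perry2026_semiregularFull_remainsAlgebraic_of_twisted` and `Perry2026_semiregular_remainsAlgebraic_of_full`.
[cite: Perry2026Semiregularity, Thm. 1.1 (2) (preprint, unrefereed)] -/
theorem semiregularTransport_zeroOne (hP : Perry2026_semiregularTwisted_remainsAlgebraic) : Perry2026_semiregular_remainsAlgebraic :=
  Perry2026_semiregular_remainsAlgebraic_of_full (Perry2026_semiregularFull_remainsAlgebraic_of_twisted hP)

/-- **Perry ⟹ a semiregularly anchored class is algebraic on EVERY fibre** (bookkeeping over the tree fact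
`Perry2026_semiregularTwisted_remainsAlgebraic`, itself `[claim, under-review]`): each `w_{i,m}(s)` is algebraic
by the semiregularity theorem with `B`-field `B_i`, and `algebraicClasses` is a `ℂ`-subspace. The base is
smooth over `ℂ`, hence reduced (`Motives.isReduced_of_smooth_over_field`, Stacks 056T), and irreducible, hence
INTEGRAL as Perry's statement requires. This is the `ℚ`-linear, any-`W` form of the tree's
`WeilTypeLadder.engine_of_perry_twisted`. [cite: Perry2026Semiregularity, Thm. 1.1 (2) (preprint, unrefereed)]
[cite: StacksProject, Tag 056T] [cite: Markman2025SecantWeil, §1.1 (the class κ; preprint, unrefereed)] -/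
theorem SemiregularAnchor.algebraic (hP : Perry2026_semiregularTwisted_remainsAlgebraic)
    {C : ChernCharacterBetti} {𝒳 S : SchemeOver ℂ} {f : 𝒳 ⟶ S} {n m : ℕ}
    (hf : IsSmoothProjectiveFamily f n) (hq : IsQuasiProjectiveOver S)
    (hirr : IrreducibleSpace S.left) (hsm : AlgebraicGeometry.Smooth S.hom)
    {W : complexBetti 𝒳 (2 * m)} (𝔞 : SemiregularAnchor C f n m W) (s : ComplexPoints S) :
    complexBetti.map (fiberι f s) (2 * m) W ∈ algebraicClasses (fiberOver f s) m := by
  haveI := hirr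
  haveI := hsm
  haveI : AlgebraicGeometry.IsReduced S.left := isReduced_of_smooth_over_field S.hom
  have hint : AlgebraicGeometry.IsIntegral S.left :=
    AlgebraicGeometry.isIntegral_of_irreducibleSpace_of_isReduced _
  rw [𝔞.sum_eq s]
  refine Submodule.sum_mem _ fun i _ => Submodule.smul_mem _ _ ?_
  exact hP C f n hf hq hint hsm (𝔞.w i) (𝔞.continuous i) (𝔞.hodge i) 𝔞.s₀ (𝔞.E i)
    (𝔞.finiteLocallyFree i) (𝔞.semiregular i) (𝔞.B i) (𝔞.rationalB i) (𝔞.algebraicB i) (𝔞.chern i) s m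

/-- **H-T2 — SEMIREGULARLY ANCHORED `K`-WEIL FAMILIES THROUGH EVERY WEIL CLASS OF A CM FIELD** (OPEN
HYPOTHESIS; Markman's programme for `[K:ℚ] > 2` in the generality R3 needs). VERBATIM the landed
`CMPointedWeilFamiliesCMField` (= R3anc `WeilTypeLadder.AnchoredWeilFamiliesCMField` data: `K = ℚ[T]/(P)` a CM
field of degree `e > 2`, `e·2m = 2 dim A`, `c ≠ 0` a rational `(m,m)` class of `weilClassesField A φ P (2m)`; a
smooth projective family of relative dimension `e·m` with quasi-projective `𝒳`, `S`, `S` smooth irreducible,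
global `W` fibrewise rational `(m,m)` and Weil-confined through abelian charts, `ι^*(W|_{s₁}) = c`) with the
LAST conjunct "a CM fibre at `s₀`" REPLACED by `Nonempty (SemiregularAnchor C f (e·m) m W)`. Perry's own
summary of the model case, verbatim (arXiv:2604.00511 §1.3): "He constructs a certain complex
`E_0 ∈ D_perf(X_0)` on the special fiber of a family `X/S` of abelian sixfolds together with an algebraic class
`B_0 ∈ H²(X_0, ℚ(1))` such that: […] The class `w_0 = exp(B_0) · ch(E_0)` remains Hodge along `S`. In these
terms, the main result of [markman] boils down to proving that `w_0` remains algebraic along `S`." What IS done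
([C] §1.1 p. 5): "In [markman-sixfolds] the flat deformations of the class `κ(Φ(F₁ ⊠ F₂^∨))` were shown to
remain algebraic, when `F = ℚ`, `X` is the Jacobian of a genus `3` curve, and the `B`-secant sheaves `F₁` and
`F₂` on `X` were chosen to be equivariantly semi-regular in the sense of Buchweitz-Flenner"; what is NOT
(ibid.): "We postpone for future work the search for semiregular `B`-secant sheaves for CM-fields with
`[K:ℚ]>2`."; [S] §12: "We expect that an affirmative answer to Question 11.4 would lead to a proof of the
algebraicity of Weil classes on some higher dimensional abelian varieties, as well as for CM-fields `K` with
`[K:ℚ]>2`". The ANCHOR of this line is a secant-sheaf member, NOT a CM point (referee C5); NOT a case of HC (it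
asserts sheaves), so no on-path lemma. Why it might fail: semiregular sheaves with prescribed `κ`-class are rare;
none is known for `[K:ℚ] > 2`; and the typed anchor wants them LOCALLY FREE (Markman's are reflexive). NOT
asserted. [cite: Perry2026Semiregularity, §1.3 (preprint, unrefereed)]
[cite: Markman2025SecantRealMultiplication, §1.1 (p. 5), Thm. 1.1.2 (p. 5), Question 11.2.2 (preprint, unrefereed)]
[cite: Markman2025SurveySecant, Lemma 11.3, Question 11.4 and §12 (preprint / ICM 2026 lecture, unrefereed)]
[cite: Markman2025SecantWeil, Thm. 1.5.1 (preprint, unrefereed)] [status: open] -/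
@[conjecture] def SemiregularlyAnchoredWeilFamiliesCMField (C : ChernCharacterBetti) : Prop :=
  ∀ (A : AbelianVariety ℂ) (φ : A ⟶ A) (P : Polynomial ℤ) (e m : ℕ),
    P.Monic → P.natDegree = e → 2 < e → Irreducible (P.map (Int.castRingHom ℚ)) →
    Polynomial.eval₂ (Int.castRingHom (End A)) (φ : End A) P = 0 →
    e * (2 * m) = 2 * A.dim →
    (∀ ρ : ℂ, Polynomial.eval₂ (Int.castRingHom ℂ) ρ P = 0 → starRingEnd ℂ ρ ≠ ρ) →
    (∃ Q : Polynomial ℚ, ∀ ρ : ℂ, Polynomial.eval₂ (Int.castRingHom ℂ) ρ P = 0 →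
        Polynomial.eval₂ (algebraMap ℚ ℂ) ρ Q = starRingEnd ℂ ρ) →
      ∀ c ∈ weilClassesField A φ P (2 * m), IsRationalClass c →
        IsOfHodgeType A.dim A.X (2 * m) m m c → c ≠ 0 →
        ∃ (𝒳 S : SchemeOver ℂ) (f : 𝒳 ⟶ S) (s₁ : ComplexPoints S)
            (ι : A.X ≅ fiberOver f s₁) (W : complexBetti 𝒳 (2 * m)),
          IsSmoothProjectiveFamily f (e * m) ∧ IsQuasiProjectiveOver 𝒳 ∧ IsQuasiProjectiveOver S ∧
          IrreducibleSpace S.left ∧ AlgebraicGeometry.Smooth S.hom ∧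
          (∀ s : ComplexPoints S,
            IsRationalClass (complexBetti.map (fiberι f s) (2 * m) W) ∧
              IsOfHodgeType (e * m) (fiberOver f s) (2 * m) m m (complexBetti.map (fiberι f s) (2 * m) W)) ∧
          (∀ s : ComplexPoints S, ∃ (A' : AbelianVariety ℂ) (φ' : A' ⟶ A') (e' : A'.X ≅ fiberOver f s),
            Polynomial.eval₂ (Int.castRingHom (End A')) (φ' : End A') P = 0 ∧ e * (2 * m) = 2 * A'.dim ∧
              complexBetti.map e'.hom (2 * m) (complexBetti.map (fiberι f s) (2 * m) W) ∈
                weilClassesField A' φ' P (2 * m)) ∧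
          complexBetti.map ι.hom (2 * m) (complexBetti.map (fiberι f s₁) (2 * m) W) = c ∧
          Nonempty (SemiregularAnchor C f (e * m) m W)

/-- **(S2) MARKMAN'S SCHEMA (kernel-checked composition).** Semiregularly anchored Weil families (OPEN) + the
semiregularity theorem H-SR (Perry's claim, under review; OPEN here) ⟹ R3 (`WeilTypeLadder.WeilClassesCMField`),
with NO CM input and NO appeal to the variational Hodge conjecture: the anchor's classes are twisted Chern
characters (algebraic for free) and the semiregularity theorem IS the transport; read back along `ι`.
ON-PATH lemma of the target = tree `WeilTypeLadder.weilClassesCMField_of_hodgeConjecture`.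
[cite: Markman2025SecantRealMultiplication, Thm. 1.1.2 (p. 5) (preprint, unrefereed)]
[cite: Perry2026Semiregularity, Thm. 1.1 (2) (preprint, unrefereed)] -/
theorem weilClassesCMField_of_semiregularlyAnchored_of_perry (C : ChernCharacterBetti)
    (hF : SemiregularlyAnchoredWeilFamiliesCMField C) (hP : Perry2026_semiregularTwisted_remainsAlgebraic) :
    WeilClassesCMField := by
  intro A φ P e m hP' hPe he hirr hφ hdim hnr hQ c hc hcQ hcH
  by_cases hc0 : c = 0
  · rw [hc0]; exact Submodule.zero_mem _
  obtain ⟨𝒳, S, f, s₁, ι, W, hf, -, hqS, hirrS, hsm, -, -, hι, ⟨𝔞⟩⟩ :=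
    hF A φ P e m hP' hPe he hirr hφ hdim hnr hQ c hc hcQ hcH hc0
  have h₁ := 𝔞.algebraic hP hf hqS hirrS hsm s₁
  rw [← hι]
  exact (mem_algebraicClasses_map_iff_of_iso ι).2 h₁

/-! ## (S3) The hybrid: a semiregular LIFT of algebraic classes at CM points (`Semiregular ⟨Weil, K CM field⟩`) -/

/-- **H-T3 — SEMIREGULAR LIFT OF ALGEBRAIC WEIL CLASSES AT CM POINTS** (OPEN HYPOTHESIS; NO statement of this
shape in print — it is the exact upgrade "Hodge-for-CM output ⟹ semiregularity-theorem input"). Along every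
smooth projective `K`-Weil family as in R3var (CM field `K = ℚ[T]/(P)` of degree `e`, relative dimension
`e·m`, quasi-projective `𝒳` and `S`, `S` smooth irreducible), for every global class `W` of degree `2m`
fibrewise rational `(m,m)` and Weil-confined through abelian charts, and every CM fibre `𝒳_{s₀} ≅ A₀.X`
(`IsOfCMType A₀`, VERBATIM the binder of `CMAbelianHodge`; conjunct order as in the landed
`CMPointedWeilFamiliesCMField`): IF `W|_{𝒳_{s₀}}` is ALGEBRAIC (what `HC_CM` delivers) THEN `W` is semiregularly
anchored (`Nonempty (SemiregularAnchor C f (e·m) m W)`). CLOSEST PRINT — all with the semiregular representative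
GIVEN, none producing it —: Markman [S] Question 11.4, SENTENCE 1 (open): "Does the Semi-regularity Theorem
hold under the weaker assumption that `σ_E` restricts to the image of `ev_E` as an injective map […]?" together
with [C] Thm. 1.1.2 (the sheaf is constructed, then deformed); Bloch 1972 Thm. 7.1 (tree
`Bloch1972_semiregularSubschemeLifts`); Buchweitz–Flenner Thm. 5.1 (tree
`BuchweitzFlenner2003_variationalHodge_semiregular`: "If there is an `I`-semiregular sheaf `ℰ_0` on `X_0` with
`α_p(0) = ch_p(ℰ_0)` […] then `α_p(s)` is algebraic for all `s` near `0`"); Perry Thm. 1.1 (2). HONEST LABEL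
(referee ref1 F5, transport seat): PLAUSIBLY FALSE AS A `∀`-STATEMENT — an algebraic class need not be a
`ℚ`-combination of (`B`-twisted) Chern characters of semiregular bundles (obstructed representatives are the
rule: the tree's `HodgeTheory/SemiregularityWeakCriterionAbelianCounterexample.lean` exhibits a sheaf satisfying
Markman's weak criterion on an abelian threefold with NO flat deformation along its Hodge locus); CM abelian
varieties are isogenous to products with large `End`, which helps supply sheaves but not their semiregularity.
The preferred form is a per-family WITNESS `Nonempty (SemiregularAnchor C f (e·m) m W)` for the specific family
at hand — which is why the anchor is DATA. NOT a case of HC (its conclusion asserts sheaves); no on-path lemma.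
NOT asserted. [cite: Markman2025SurveySecant, Question 11.4 sentence 1 and §12 (preprint / ICM 2026 lecture, unrefereed)]
[cite: Markman2025SecantRealMultiplication, Thm. 1.1.2 (preprint, unrefereed)]
[cite: Bloch1972Semiregularity, Thm. (7.1) and (7.4)] [cite: BuchweitzFlenner2003, §5 Thm. 5.1]
[cite: Perry2026Semiregularity, Thm. 1.1 (2) (preprint, unrefereed)] [status: open] -/
@[conjecture] def SemiregularLiftAtCMPoints (C : ChernCharacterBetti) : Prop :=
  ∀ (P : Polynomial ℤ) (e m : ℕ), P.Monic → P.natDegree = e → Irreducible (P.map (Int.castRingHom ℚ)) →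
    (∀ ρ : ℂ, Polynomial.eval₂ (Int.castRingHom ℂ) ρ P = 0 → starRingEnd ℂ ρ ≠ ρ) →
    (∃ Q : Polynomial ℚ, ∀ ρ : ℂ, Polynomial.eval₂ (Int.castRingHom ℂ) ρ P = 0 →
        Polynomial.eval₂ (algebraMap ℚ ℂ) ρ Q = starRingEnd ℂ ρ) →
    ∀ ⦃𝒳 S : SchemeOver ℂ⦄ (f : 𝒳 ⟶ S), IsSmoothProjectiveFamily f (e * m) →
      IsQuasiProjectiveOver 𝒳 → IsQuasiProjectiveOver S → IrreducibleSpace S.left →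
      AlgebraicGeometry.Smooth S.hom →
      ∀ (W : complexBetti 𝒳 (2 * m)),
        (∀ s : ComplexPoints S,
          IsRationalClass (complexBetti.map (fiberι f s) (2 * m) W) ∧
            IsOfHodgeType (e * m) (fiberOver f s) (2 * m) m m (complexBetti.map (fiberι f s) (2 * m) W)) →
        (∀ s : ComplexPoints S, ∃ (A' : AbelianVariety ℂ) (φ' : A' ⟶ A') (e' : A'.X ≅ fiberOver f s),
          Polynomial.eval₂ (Int.castRingHom (End A')) (φ' : End A') P = 0 ∧ e * (2 * m) = 2 * A'.dim ∧
            complexBetti.map e'.hom (2 * m) (complexBetti.map (fiberι f s) (2 * m) W) ∈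
              weilClassesField A' φ' P (2 * m)) →
        ∀ (s₀ : ComplexPoints S) (A₀ : AbelianVariety ℂ), Nonempty (A₀.X ≅ fiberOver f s₀) →
          A₀.dim = e * m → IsOfCMType A₀ →
          complexBetti.map (fiberι f s₀) (2 * m) W ∈ algebraicClasses (fiberOver f s₀) m →
          Nonempty (SemiregularAnchor C f (e * m) m W)

/-- `HC_CM` + the landed CM-pointed `K`-Weil families + the semiregular lift at CM points ⟹ semiregularly
anchored families (kernel-checked): the CM fibre's Hodge conjecture (`mem_algebraicClasses_of_cmChart`, landed)
discharges the antecedent "`W|_{s₀}` algebraic" of H-T3. `HC_CM` is consumed exactly once, here.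
[cite: Deligne1982HodgeCycles, §6 Prop. 6.1] [cite: BuchweitzFlenner2003, §5 Thm. 5.1] -/
theorem semiregularlyAnchored_of_HC_CM_of_cmPointed_of_lift (C : ChernCharacterBetti)
    (hCM : Theses.RankFourFaces.CMAbelianHodge) (hF : CMPointedWeilFamiliesCMField)
    (hL : SemiregularLiftAtCMPoints C) : SemiregularlyAnchoredWeilFamiliesCMField C := by
  intro A φ P e m hP hPe he hirr hφ hdim hnr hQ c hc hcQ hcH hc0
  obtain ⟨𝒳, S, f, s₁, s₀, ι, W, hf, hq𝒳, hqS, hirrS, hsm, hW, hch, hι, A₀, ⟨e₀⟩, hdim₀, hA₀⟩ :=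
    hF A φ P e m hP hPe he hirr hφ hdim hnr hQ c hc hcQ hcH hc0
  have h₀ : complexBetti.map (fiberι f s₀) (2 * m) W ∈ algebraicClasses (fiberOver f s₀) m :=
    mem_algebraicClasses_of_cmChart hCM A₀ e₀ hdim₀ hA₀ (hW s₀).1 (hW s₀).2
  exact ⟨𝒳, S, f, s₁, ι, W, hf, hq𝒳, hqS, hirrS, hsm, hW, hch, hι,
    hL P e m hP hPe hirr hnr hQ f hf hq𝒳 hqS hirrS hsm W hW hch s₀ A₀ ⟨e₀⟩ hdim₀ hA₀ h₀⟩

/-- **(S3) `HC_WeilClassesCMField_of_HC_CM_of_semiregularLift` — THE HYBRID SCHEMA (kernel-checked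
composition).** `HC_CM → CMPointedWeilFamiliesCMField → SemiregularLiftAtCMPoints C → H-SR (Perry) →
WeilClassesCMField`: the CM hypothesis is consumed exactly once (anchor algebraicity), H-T3 upgrades it to a
semiregular presentation, Perry's theorem transports. The transport row on which `HC_CM` is load-bearing IN
PRINT (ref1 F2: non-split Weil type over a CM field of degree `> 2`). CONDITIONAL on four open hypotheses;
ON-PATH lemma of the target = tree `WeilTypeLadder.weilClassesCMField_of_hodgeConjecture`.
[cite: Perry2026Semiregularity, Thm. 1.1 (2) (preprint, unrefereed)] [cite: Milne1999, §7 p. 72]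
[cite: Markman2025SurveySecant, §12 (preprint / ICM 2026 lecture, unrefereed)] -/
theorem HC_WeilClassesCMField_of_HC_CM_of_semiregularLift (C : ChernCharacterBetti)
    (hCM : Theses.RankFourFaces.CMAbelianHodge) (hF : CMPointedWeilFamiliesCMField)
    (hL : SemiregularLiftAtCMPoints C) (hP : Perry2026_semiregularTwisted_remainsAlgebraic) : WeilClassesCMField :=
  weilClassesCMField_of_semiregularlyAnchored_of_perry C
    (semiregularlyAnchored_of_HC_CM_of_cmPointed_of_lift C hCM hF hL) hP

/-! ## Audit: nothing is decided here

Every theorem above whose conclusion is a Weil rung has among its hypotheses an OPEN named statement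
(`Perry2026_semiregularTwisted_remainsAlgebraic` — Perry's theorem, unformalised; `SemiregularlyAnchoredWeilFamiliesCMField`;
`SemiregularLiftAtCMPoints`, plausibly false as a `∀`) and, on the (S3) row, `HC_CM` by name. Axiom closures:
the three standard axioms only. -/

#print axioms Summit.HodgeConjecture.HodgeConjecture.Ring2Transport.SemiregularAnchor.algebraic
#print axioms Summit.HodgeConjecture.HodgeConjecture.Ring2Transport.weilClassesCMField_of_semiregularlyAnchored_of_perry
#print axioms Summit.HodgeConjecture.HodgeConjecture.Ring2Transport.HC_WeilClassesCMField_of_HC_CM_of_semiregularLift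

end Summit.HodgeConjecture.HodgeConjecture.Ring2Transport

end
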